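import Literature.MathematicalPhysics.QuantumFieldTheory.Balaban1983to89.Beta.OneStepKernelFamily
import Literature.MathematicalPhysics.QuantumFieldTheory.Balaban1983to89.Beta.DyadicShell

/-!
# `BalabanUV.Beta.FP.EvenKernelNoGo` — road «FP» for binder row D1, organisation γ: A KERNEL NO-GO ON THE EVENNESS LETTER `heven` OF THE γ-END CHAIN
# (FINDING F-d1leaf01g10-1): an entrywise EVEN kernel with the PRINTED reflection covariance (5.7) has IDENTICALLY VANISHING off-diagonal channels,
# and then the windowed germ letter `hgerm` at `μ ≠ ν` forces the slope `s = 0`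

HONEST DEPENDENCY (page 1, mandatory): continuum YM on T⁴ ⇐ BetaPertH ∧ nine spine estimates (0/9 proved); BetaPertH ⇐ (D1) ∧ (D4) ∧
CAP+tail; G-an2-4 gates asym, D1 and NE2/3/4.  HONEST FRAMING (cell contract, verbatim): «discharging `BetaPertH` makes Bałaban's UV
stability UNCONDITIONAL — a real constructive-QFT result; it is NOT the continuum limit and NOT the Clay problem.»  THIS MODULE is elementary
[folklore] re-indexing on `ℤ⁴` over the tree's [cite]-tagged PREDICATE `PolarizationSign.AxisReflectionCovariant` ((5.7)–(5.8) p. 293 of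
[Balaban1987RG1], typed by the lead; a HYPOTHESIS here, asserted of nothing) and an2's `OneStepKernelFamily.flipK`.  It proves NO estimate of
Bałaban's objects, cites nothing, mints no `def … : Prop`, has no `def` at all; 0 sorry.  0∕4 row-D1 binders.  NOT hbook, NOT hasym, NOT D1,
NOT BetaPertH, NOT continuum, NOT Clay.

ABSOLUTE RULE (cell charter, verbatim): «No internally-minted statement may enter as a cited fact. Every hypothesis is either kernel-proved in this
package or a verbatim quotation of a PUBLISHED theorem with page reference. The manuscript(s) under audit are NOT citable for their own disputed
steps — they are the thing under adjudication; programme-internal (2001/route/tribunal) claims are never citable.»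

WHY (FINDING F-d1leaf01g10-1, `HOME/GAPS.md`; journal 2026-08-21T03:36Z).  The γ-END chain of road FP — `FP/HorizontalBookkeeping.secondMoment_dressedEntry_hasSum_lattice_t0Defect`
∕ `truncK_even` → `FP/HorizontalTailAssembly.hasSum_truncatedTransport` → `FP/HorizontalRemainderPerfect.{end_of_remainder_expL1, hbook∕hasym_perfect_of_remainder}` →
`FP/RemainderLedger.hasym_perfect_of_pieces` — carries the letter `heven : ∀ c e t, K c e (−t) = K c e t` («(T1) discharged by EVENNESS of T»), and
ruling R-FP-30 books it for the road's transported kernel as «(Kev) = N3 ✓ `AxisReflectionCovariant` under the full inversion, signs cancel pairwise».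
The signs do cancel — but the PRINTED BOND SHIFTS `−[μ=α]e_α + [ν=α]e_α` of (5.7) do not: reflecting the axis of the LEFT index alone gives, for `μ ≠ ν`,
`P_{μν}(ε_μ z − e_μ) = −P_{μν}(z)` (tree: `OddMoments.firstMoment_eq_zero_of_refl_left`'s mechanism), so an EVEN `P` has `P_{μν}(w + e_μ) = P_{μν}(w − e_μ)`:
the off-diagonal channel is `2e_μ`-PERIODIC (the remark already printed at `OneStepKernelFamily.flipK`: «a kernel satisfying BOTH reflection laws has
`2e_α`-periodic off-diagonal channels, hence — if it decays — vanishing ones»; `heven` is literally `flipK K = K`, i.e. both laws at once), and a periodic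
channel with the END's sextic decay (K6) is ZERO.  Then the END's `hgerm` at `μ ≠ ν` (the only case `FP/HorizontalGerm.hgerm_of_leadingGerm (hμν : μ ≠ ν)` and
`FP/AsymptoticEnd` consume) reads `|0 − (s·log M + c₀)| ≤ Cg` for all `M ≥ 1`, which forces `s = 0`.  So the ENDs are correct theorems whose `heven` socket no
reflection-covariant kernel with a non-zero off-diagonal channel can fill — in particular not the road's `K = PiBF …` (off-diagonal germ `kappaBal N·transverseUnit`).
REPAIR (F-d1leaf01g10-1 (R2)): replace `heven` by (5.7); the first moments of the TRUNCATED kernel are then one boundary shell, `|M₁(truncK K N c e)| ≤ 80C∕(N+1)²`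
(v1.1 DOCFIX, XREAD C-gan24leaf03-g46-5∕-6 NIT: the landed letter counts the two spheres `‖t‖∞ ∈ {N, N+1}` — constant `80C`; the sharper one-slab count `8C` is NOT what the tree proves)
(`FP/TruncatedFirstMoment`, this seat), and the nine-term identity's m₁-terms cost `O(1∕N)` in the END's own currency.

CONTENT (all [folklore]; `P : B12Beta.Kernel d` for §1, `K : EKer 4` with an2's `flipK` for §2–§3):
* §1 `neg_of_refl_left` ((5.7) at the left index's axis, `μ ≠ ν`: `P μ ν (ε_μ z − e_μ) = −P μ ν z`), **`periodic_of_even_of_cov`** (`+ heven ⟹ P μ ν (w + e_μ) = P μ ν (w − e_μ)`),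
  `periodic_two_nsmul` (`P μ ν (w + (2n)•e_μ) = P μ ν w`).
* §2 (`d = 4`, the END's decay shape) **`offDiag_eq_zero_of_even_of_cov`** (`heven ∧ AxisReflectionCovariant K ∧ (K6) ⟹ K μ ν ≡ 0` for `μ ≠ ν`) and the twin
  **`offDiag_eq_zero_of_even_of_cov_flip`** with `AxisReflectionCovariant (flipK K)` (the wall's hR ∕ road FP's N3 shape; under `heven`, `flipK K = K`).
* §3 `slope_eq_zero_of_windowBound` (`|s·log M + c₀| ≤ Cg ∀ M ≥ 1 ⟹ s = 0`), and THE NO-GO IN THE END'S EXACT BINDER SHAPES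
  **`hasym_hypotheses_degenerate_flip`** ∕ **`hasym_hypotheses_degenerate`**: `hK` (K6), `heven`, `hgerm` of `HorizontalRemainderPerfect.hasym_perfect_of_remainder` at
  `μ ≠ ν`, plus the road's reflection covariance ⟹ `s = 0` (and every window sum `Σ_{z ∈ annulus 4 0 M} K μ ν z·z_μ·z_ν = 0`).
Provenance: D1 formalisation swarm, unit b2b-balaban-beta-d1-formalise-leaf-01 gen 10 (prover-b2b-balaban-beta-d1-formalise-leaf-01-g10-0), 2026-08-21,
FINDING F-d1leaf01g10-1; «not in print; our bookkeeping».
-/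

noncomputable section

namespace Summit.QuantumFields.BalabanUV.Beta.FP.EvenKernelNoGo

open Finset
open Literature.Probability.LatticeModels (annulus)
open Literature.MathematicalPhysics.QuantumFieldTheory.Balaban1983to89
open Literature.MathematicalPhysics.QuantumFieldTheory.Balaban1983to89.Beta
open Literature.MathematicalPhysics.QuantumFieldTheory.Balaban1983to89.B6BondElimination (unitVec unitVec_apply)
open PolarizationSign (AxisReflectionCovariant axisReflect axisReflect_apply axisReflect_axisReflect reflSign)
open OneStepKernelFamily (flipK flipK_apply)
open DressedMomentNormalisation (EKer)
open DyadicShell (Pt supNorm natAbs_le_supNorm)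

/-! ## §1 One axis reflection + evenness ⟹ a `2e_μ`-periodic off-diagonal channel (any dimension) -/

section General

variable {d : ℕ}

/-- [folklore] (5.7) AT THE AXIS OF THE LEFT INDEX, `μ ≠ ν`: `P μ ν (ε_μ z − e_μ) = −P μ ν z` (the right index's shift is absent, the sign is `ε_μ^μ·ε_μ^ν = −1`). -/
theorem neg_of_refl_left {P : B12Beta.Kernel d} (hR : AxisReflectionCovariant P) {μ ν : Fin d} (hμν : μ ≠ ν) (z : Fin d → ℤ) :
    P μ ν (axisReflect μ z - unitVec μ) = -P μ ν z := by
  have h0 := hR μ μ ν z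
  simp only [reflSign, if_true, if_neg (Ne.symm hμν), add_zero] at h0
  rw [h0]; ring

/-- [folklore] `ε_μ(−w) = −ε_μ w`. -/
theorem axisReflect_neg (α : Fin d) (w : Fin d → ℤ) : axisReflect α (-w) = -axisReflect α w := by
  funext i
  simp only [axisReflect_apply, Pi.neg_apply]
  split_ifs <;> simp

/-- [folklore] **EVENNESS + (5.7) ⟹ PERIODICITY.**  If the channel `P μ ν` (`μ ≠ ν`) is EVEN, `P μ ν (−t) = P μ ν t`, and `P` is axis-reflection covariant in the
printed sense (5.7), then `P μ ν (w + e_μ) = P μ ν (w − e_μ)` for every `w`: reflect the left index's axis at `ε_μ w` and at `ε_μ(−w)`. -/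
theorem periodic_of_even_of_cov {P : B12Beta.Kernel d} (hR : AxisReflectionCovariant P) {μ ν : Fin d} (hμν : μ ≠ ν)
    (heven : ∀ t, P μ ν (-t) = P μ ν t) (w : Fin d → ℤ) : P μ ν (w + unitVec μ) = P μ ν (w - unitVec μ) := by
  have h1 := neg_of_refl_left hR hμν (axisReflect μ w)
  have h2 := neg_of_refl_left hR hμν (axisReflect μ (-w))
  rw [axisReflect_axisReflect] at h1 h2
  rw [axisReflect_neg, heven] at h2
  -- h1 : P μ ν (w - e_μ) = -P μ ν (ε_μ w);  h2 : P μ ν (-w - e_μ) = -P μ ν (ε_μ w)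
  have h3 : P μ ν (-w - unitVec μ) = P μ ν (w + unitVec μ) := by
    rw [← heven (w + unitVec μ), neg_add']
  rw [← h3, h2, h1]

/-- [folklore] Hence `P μ ν (w + (2n)•e_μ) = P μ ν w` for every `n : ℕ`. -/
theorem periodic_two_nsmul {P : B12Beta.Kernel d} (hR : AxisReflectionCovariant P) {μ ν : Fin d} (hμν : μ ≠ ν)
    (heven : ∀ t, P μ ν (-t) = P μ ν t) (w : Fin d → ℤ) (n : ℕ) : P μ ν (w + ((2 * n : ℕ) : ℤ) • unitVec μ) = P μ ν w := by
  induction n with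
  | zero => simp
  | succ n ih =>
    have h := periodic_of_even_of_cov hR hμν heven (w + ((2 * n : ℕ) : ℤ) • unitVec μ + unitVec μ)
    rw [add_sub_cancel_right, ih] at h
    have e1 : ((2 * (n + 1) : ℕ) : ℤ) • unitVec μ = ((2 * n : ℕ) : ℤ) • unitVec μ + unitVec μ + unitVec μ := by
      have e0 : ((2 * (n + 1) : ℕ) : ℤ) = ((2 * n : ℕ) : ℤ) + 1 + 1 := by push_cast; ring
      rw [e0, add_smul, add_smul, one_smul]
    rw [e1, ← add_assoc, ← add_assoc]
    exact h

end General

/-! ## §2 `d = 4`: a periodic channel with the END's sextic decay vanishes -/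

section Four

/-- [folklore] The `μ`-coordinate of `w + m•e_μ` has absolute value at least `m − |w_μ|`; hence `m ≤ ‖w + m•e_μ‖∞ + ‖w‖∞`. -/
theorem le_supNorm_add_nsmul (w : Pt) (μ : Fin 4) (m : ℕ) : m ≤ supNorm (w + (m : ℤ) • unitVec μ) + supNorm w := by
  have h1 : ((w + (m : ℤ) • unitVec μ) μ).natAbs ≤ supNorm (w + (m : ℤ) • unitVec μ) := natAbs_le_supNorm _ μ
  have h2 : (w μ).natAbs ≤ supNorm w := natAbs_le_supNorm w μ
  have h3 : (w + (m : ℤ) • unitVec μ) μ = w μ + m := by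
    simp [unitVec_apply]
  rw [h3] at h1
  have h4 : m ≤ (w μ + (m : ℤ)).natAbs + (w μ).natAbs := by
    have := Int.natAbs_sub_le (w μ + (m : ℤ)) (w μ)
    simp only [add_sub_cancel_left, Int.natAbs_natCast] at this
    exact this
  omega

/-- [folklore] A channel that is `2e_μ`-periodic and decays like `C∕(‖t‖∞+1)⁶` (the γ-END's (K6) shape; any decay to zero would do) vanishes identically. -/
theorem eq_zero_of_periodic_of_decay {f : Pt → ℝ} {C : ℝ} (μ : Fin 4)
    (hper : ∀ (w : Pt) (n : ℕ), f (w + ((2 * n : ℕ) : ℤ) • unitVec μ) = f w)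
    (hf : ∀ t : Pt, |f t| ≤ C / ((supNorm t : ℝ) + 1) ^ 6) (w : Pt) : f w = 0 := by
  have hC : 0 ≤ C := by
    have h := hf 0
    have hp : (0 : ℝ) < ((supNorm (0 : Pt) : ℝ) + 1) ^ 6 := by positivity
    exact (div_nonneg_iff.mp ((abs_nonneg _).trans h)).elim (fun h => h.1) fun h => absurd h.2 (not_le.mpr hp)
  -- for every `m`, `|f w| ≤ C / (m + 1)^6`
  have hb : ∀ m : ℕ, |f w| ≤ C / ((m : ℝ) + 1) ^ 6 := by
    intro m
    set n : ℕ := supNorm w + m with hn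
    have hle := le_supNorm_add_nsmul w μ (2 * n)
    rw [← hper w n]
    refine (hf _).trans ?_
    have hm : (m : ℝ) + 1 ≤ (supNorm (w + ((2 * n : ℕ) : ℤ) • unitVec μ) : ℝ) + 1 := by
      have : m ≤ supNorm (w + ((2 * n : ℕ) : ℤ) • unitVec μ) := by omega
      exact_mod_cast Nat.add_le_add_right this 1
    exact div_le_div_of_nonneg_left hC (by positivity) (pow_le_pow_left₀ (by positivity) hm 6)
  -- if `f w ≠ 0`, take `m + 1 > C / |f w|`
  by_contra hne
  have hpos : 0 < |f w| := abs_pos.mpr hne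
  obtain ⟨m, hm⟩ := exists_nat_gt (C / |f w|)
  have h1 : C / ((m : ℝ) + 1) ^ 6 ≤ C / ((m : ℝ) + 1) := by
    refine div_le_div_of_nonneg_left hC (by positivity) ?_
    calc ((m : ℝ) + 1) = ((m : ℝ) + 1) ^ 1 := (pow_one _).symm
      _ ≤ ((m : ℝ) + 1) ^ 6 := pow_le_pow_right₀ (by linarith [(Nat.cast_nonneg m : (0 : ℝ) ≤ m)]) (by norm_num)
  have h2 : C / ((m : ℝ) + 1) < |f w| := by
    rw [div_lt_iff₀ (by positivity)]
    have h3 : C < |f w| * (m : ℝ) := by rwa [div_lt_iff₀ hpos, mul_comm] at hm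
    nlinarith
  linarith [hb m]

/-- **NO-GO (unflipped covariance).**  An entrywise EVEN kernel on `ℤ⁴` with the printed reflection covariance (5.7) and the γ-END's sextic decay has
IDENTICALLY VANISHING OFF-DIAGONAL CHANNELS: `K μ ν t = 0` for all `t`, `μ ≠ ν`. [folklore] -/
theorem offDiag_eq_zero_of_even_of_cov {K : EKer 4} {C : ℝ} (hK : ∀ c e (t : Pt), |K c e t| ≤ C / ((supNorm t : ℝ) + 1) ^ 6)
    (heven : ∀ c e (t : Pt), K c e (-t) = K c e t) (hcov : AxisReflectionCovariant K) {μ ν : Fin 4} (hμν : μ ≠ ν) (t : Pt) :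
    K μ ν t = 0 :=
  eq_zero_of_periodic_of_decay (f := K μ ν) μ (fun w n => periodic_two_nsmul hcov hμν (heven μ ν) w n) (hK μ ν) t

/-- [folklore] Under `heven` the flip is invisible: `flipK K = K`. -/
theorem flipK_eq_self_of_even {K : EKer 4} (heven : ∀ c e (t : Pt), K c e (-t) = K c e t) : flipK K = K := by
  funext c e t; rw [flipK_apply, heven]

/-- **NO-GO (covariance of the FLIPPED kernel — the wall's hR ∕ road FP's N3 shape `AxisReflectionCovariant (flipK K)`).**  Same conclusion: `K μ ν ≡ 0` for `μ ≠ ν`. [folklore] -/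
theorem offDiag_eq_zero_of_even_of_cov_flip {K : EKer 4} {C : ℝ} (hK : ∀ c e (t : Pt), |K c e t| ≤ C / ((supNorm t : ℝ) + 1) ^ 6)
    (heven : ∀ c e (t : Pt), K c e (-t) = K c e t) (hcov : AxisReflectionCovariant (flipK K)) {μ ν : Fin 4} (hμν : μ ≠ ν) (t : Pt) :
    K μ ν t = 0 := by
  rw [flipK_eq_self_of_even heven] at hcov
  exact offDiag_eq_zero_of_even_of_cov hK heven hcov hμν t

end Four

/-! ## §3 The slope no-go in the γ-END's binder shapes -/

section Slope

/-- [folklore] If `|s·log M + c₀| ≤ Cg` for every `M ≥ 1` then `s = 0` (`log` is unbounded). -/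
theorem slope_eq_zero_of_windowBound {s c₀ Cg : ℝ} (h : ∀ M : ℕ, 1 ≤ M → |s * Real.log M + c₀| ≤ Cg) : s = 0 := by
  by_contra hs
  have hs' : 0 < |s| := abs_pos.mpr hs
  set L : ℝ := (Cg + |c₀| + 1) / |s| with hL
  obtain ⟨M, hM⟩ := exists_nat_gt (Real.exp L)
  have hMpos : (0 : ℝ) < M := (Real.exp_pos L).trans hM
  have hM1 : 1 ≤ M := by exact_mod_cast (show (0 : ℝ) < M from hMpos)
  have hlog : L ≤ Real.log M := by
    rw [← Real.log_exp L]
    exact Real.log_le_log (Real.exp_pos L) hM.le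
  have h1 := h M hM1
  have h2 : |s| * Real.log M - |c₀| ≤ |s * Real.log M + c₀| := by
    have := abs_add_le (s * Real.log M + c₀) (-c₀)
    rw [add_neg_cancel_right, abs_mul, abs_neg, abs_of_nonneg (Real.log_nonneg (by exact_mod_cast hM1))] at this
    linarith
  have h3 : |s| * L ≤ |s| * Real.log M := mul_le_mul_of_nonneg_left hlog hs'.le
  have h4 : |s| * L = Cg + |c₀| + 1 := by rw [hL]; field_simp
  linarith

/-- [folklore] A vanishing channel has vanishing window second moments. -/
theorem windowSum_eq_zero {K : EKer 4} {μ ν : Fin 4} (h0 : ∀ t : Pt, K μ ν t = 0) (M : ℕ) :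
    ∑ z ∈ annulus 4 0 M, K μ ν z * (z μ : ℝ) * (z ν : ℝ) = 0 :=
  Finset.sum_eq_zero fun z _ => by rw [h0 z, zero_mul, zero_mul]

/-- [folklore] `hgerm` on a vanishing channel forces the slope `s = 0`. -/
theorem slope_eq_zero_of_hgerm_of_zero {K : EKer 4} {μ ν : Fin 4} (h0 : ∀ t : Pt, K μ ν t = 0) {s c₀ Cg : ℝ}
    (hgerm : ∀ M : ℕ, 1 ≤ M → |∑ z ∈ annulus 4 0 M, K μ ν z * (z μ : ℝ) * (z ν : ℝ) - (s * Real.log M + c₀)| ≤ Cg) : s = 0 := by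
  refine slope_eq_zero_of_windowBound (c₀ := c₀) (Cg := Cg) fun M hM => ?_
  have h := hgerm M hM
  rwa [windowSum_eq_zero h0 M, zero_sub, abs_neg] at h

/-- **THE NO-GO IN THE γ-END's EXACT BINDER SHAPES (flipped covariance).**  The hypotheses `hK` (K6), `heven` (Kev) and `hgerm` of
`FP/HorizontalRemainderPerfect.hasym_perfect_of_remainder` ∕ `FP/RemainderLedger.hasym_perfect_of_pieces` at an OFF-DIAGONAL channel `μ ≠ ν`, together with the
reflection covariance the road proves for its kernels (`AxisReflectionCovariant (flipK K)`, N3), force the slope `s = 0`: the END can only be instantiated in the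
degenerate case.  (FINDING F-d1leaf01g10-1; repair: replace `heven` by (5.7), `FP/TruncatedFirstMoment`.) [folklore] -/
theorem hasym_hypotheses_degenerate_flip {K : EKer 4} {C : ℝ}
    (hK : ∀ c' e (t : Pt), |K c' e t| ≤ C / ((supNorm t : ℝ) + 1) ^ 6)
    (heven : ∀ c' e (t : Pt), K c' e (-t) = K c' e t) (hcov : AxisReflectionCovariant (flipK K))
    {μ ν : Fin 4} (hμν : μ ≠ ν) {s c₀ Cg : ℝ}
    (hgerm : ∀ M : ℕ, 1 ≤ M → |∑ z ∈ annulus 4 0 M, K μ ν z * (z μ : ℝ) * (z ν : ℝ) - (s * Real.log M + c₀)| ≤ Cg) :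
    s = 0 ∧ ∀ t : Pt, K μ ν t = 0 :=
  have h0 : ∀ t : Pt, K μ ν t = 0 := offDiag_eq_zero_of_even_of_cov_flip hK heven hcov hμν
  ⟨slope_eq_zero_of_hgerm_of_zero h0 hgerm, h0⟩

/-- **THE NO-GO IN THE γ-END's EXACT BINDER SHAPES (unflipped covariance `AxisReflectionCovariant K`).** [folklore] -/
theorem hasym_hypotheses_degenerate {K : EKer 4} {C : ℝ}
    (hK : ∀ c' e (t : Pt), |K c' e t| ≤ C / ((supNorm t : ℝ) + 1) ^ 6)
    (heven : ∀ c' e (t : Pt), K c' e (-t) = K c' e t) (hcov : AxisReflectionCovariant K)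
    {μ ν : Fin 4} (hμν : μ ≠ ν) {s c₀ Cg : ℝ}
    (hgerm : ∀ M : ℕ, 1 ≤ M → |∑ z ∈ annulus 4 0 M, K μ ν z * (z μ : ℝ) * (z ν : ℝ) - (s * Real.log M + c₀)| ≤ Cg) :
    s = 0 ∧ ∀ t : Pt, K μ ν t = 0 :=
  have h0 : ∀ t : Pt, K μ ν t = 0 := offDiag_eq_zero_of_even_of_cov hK heven hcov hμν
  ⟨slope_eq_zero_of_hgerm_of_zero h0 hgerm, h0⟩

end Slope

end Summit.QuantumFields.BalabanUV.Beta.FP.EvenKernelNoGo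

end
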